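import Summits.Ventures.PercRepro2.CaseOneLeafDelete
import Summits.Ventures.PercRepro2.CaseOnePendantNec

/-!
# Splitting the product law at one edge (blind cell PercRepro2, p1 g29; the tool for the pendant
root at the statement vertex)

For an edge `e₀`, every event of `G` whose membership is decided by the state of `e₀` together with
the restricted configuration — `ω ∈ A ⟺ (e₀ closed ∧ ω|_{E∖e₀} ∈ X₀) ∨ (e₀ open ∧ ω|_{E∖e₀} ∈ X₁)` —
has probability `(1 − p(e₀)) · P′(X₀) + p(e₀) · P′(X₁)` under the restricted weights
(**`prob_split_edge`**; the two halves `prob_closedEdge_inter_preimage`,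
`prob_openEdge_inter_preimage`). This is the exploration identity of `Defs` read on `G − e₀`. Own
code; standard axioms.
-/

namespace Summit.Ventures.PercRepro2

namespace CaseOne

section Split
variable {E : Type*} [Fintype E] [DecidableEq E] {R : Type*} [CommRing R]

omit [Fintype E] in
/-- The indicator of a preimage from `G − e₀` ignores `e₀`. -/
lemma indicator_preimage_restrict_update (e₀ : E) (X : Set (Config {e : E // e ≠ e₀}))
    (ω : Config E) (c : Bool) :
    (restrictCfg e₀ ⁻¹' X).indicator (1 : Config E → R) (Function.update ω e₀ c) =
      (restrictCfg e₀ ⁻¹' X).indicator 1 ω := by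
  by_cases h : ω ∈ restrictCfg e₀ ⁻¹' X
  · rw [Set.indicator_of_mem h, Set.indicator_of_mem (by simpa [Set.mem_preimage] using h)]
    rfl
  · rw [Set.indicator_of_notMem h, Set.indicator_of_notMem (by simpa [Set.mem_preimage] using h)]

/-- `P({e₀ open} ∩ X) = p(e₀) · P′(X)` for an event `X` of `G − e₀`. -/
lemma prob_openEdge_inter_preimage (p : E → R) (e₀ : E) (X : Set (Config {e : E // e ≠ e₀})) :
    prob p (openEdge e₀ ∩ restrictCfg e₀ ⁻¹' X) = p e₀ * prob (restrictW p e₀) X := by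
  rw [Set.inter_comm, prob_inter_openEdge, prob_update_of_ignore p e₀ 1 _
    (indicator_preimage_restrict_update e₀ X), prob_restrict]

/-- `P({e₀ closed} ∩ X) = (1 − p(e₀)) · P′(X)` for an event `X` of `G − e₀`. -/
lemma prob_closedEdge_inter_preimage (p : E → R) (e₀ : E) (X : Set (Config {e : E // e ≠ e₀})) :
    prob p (closedEdge e₀ ∩ restrictCfg e₀ ⁻¹' X) = (1 - p e₀) * prob (restrictW p e₀) X := by
  rw [Set.inter_comm, prob_inter_closedEdge, prob_update_of_ignore p e₀ 0 _
    (indicator_preimage_restrict_update e₀ X), prob_restrict]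

/-- **Splitting at `e₀`**: an event decided by the state of `e₀` and the restricted configuration. -/
theorem prob_split_edge (p : E → R) (e₀ : E) (A : Set (Config E))
    (X₀ X₁ : Set (Config {e : E // e ≠ e₀}))
    (hA : ∀ ω : Config E, ω ∈ A ↔
      (ω e₀ = false ∧ restrictCfg e₀ ω ∈ X₀) ∨ (ω e₀ = true ∧ restrictCfg e₀ ω ∈ X₁)) :
    prob p A = (1 - p e₀) * prob (restrictW p e₀) X₀ + p e₀ * prob (restrictW p e₀) X₁ := by
  have hset : A = (closedEdge e₀ ∩ restrictCfg e₀ ⁻¹' X₀) ∪ (openEdge e₀ ∩ restrictCfg e₀ ⁻¹' X₁) := by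
    ext ω
    rw [hA ω]
    simp only [Set.mem_union, Set.mem_inter_iff, Set.mem_preimage, closedEdge, openEdge,
      Set.mem_setOf_eq]
  have hdisj : Disjoint (closedEdge e₀ ∩ restrictCfg e₀ ⁻¹' X₀)
      (openEdge e₀ ∩ restrictCfg e₀ ⁻¹' X₁) := by
    rw [Set.disjoint_left]
    rintro ω ⟨h0, _⟩ ⟨h1, _⟩
    simp only [closedEdge, openEdge, Set.mem_setOf_eq] at h0 h1
    rw [h0] at h1
    exact Bool.false_ne_true h1
  rw [hset, prob_union_of_disjoint p hdisj, prob_closedEdge_inter_preimage,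
    prob_openEdge_inter_preimage]

end Split

end CaseOne

end Summit.Ventures.PercRepro2
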